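import Literature.MathematicalPhysics.QuantumLattice.OverlapLocality
import Literature.MathematicalPhysics.QuantumLattice.GaugeGroups
import Literature.MathematicalPhysics.QuantumLattice.GrassmannIntegralProofs
import Literature.MathematicalPhysics.QuantumFieldTheory.QCDHeavyQuarkPropagator
import HarnessLib

/-!
# WORKFILE (crux stmt-QuantumFields-11512): clause (T0)-positivity of the two-star bounds, for ALL parameters

Self-contained tree copy of the three Literature candidates prepared by the lead
(`TwistedTorusShifts.lean` + `TwistedFreeWilsonDirac.lean` + `QCDPhaseQuenchedPositivity.lean`, proposals pending):
`0 < ∫ ‖det (diracMatrix U mq)‖ dμ_W(β)` for every `N_f`, mass tuple, `β ∈ ℝ` and torus side — via the constant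
diagonal `SU(3)` twist whose free Wilson operator has no zero modes at any real mass. Origin: stub worker of
`stub_twoStar` (wave 1), restyled. Kept here so that future seats of this crux can read the proof (item evidence
files are not mounted in prover jails).
-/

/-!
# Forward shift matrices of the discrete four-torus and the constant diagonal `SU(3)` twist

Topic `Literature/MathematicalPhysics/QuantumLattice`; namespace
`Literature.MathematicalPhysics.QuantumLattice`.

The site translation `x ↦ x + μ̂` of the periodic lattice `(ℤ/L)⁴` as a `0/1` matrix
`T_μ(x,y) = [y = x + μ̂]` (`torusShiftMat L μ`) — the `U ≡ 1` case of the gauge-covariant forward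
shift `linkHop` of `OverlapLocality.lean` — with the algebra used by free-field computations on
the torus: the `T_μ` pairwise commute, commute with every `T_νᴴ`, are unitary, and `T_μ^L = 1`
(Montvay–Münster 1994 §4.2, lattice momenta of the periodic torus; here in position space, so that
no Fourier analysis on `ZMod L` is needed).

Second part (`TwistedFreeWilson.*`): the constant twisted link `g = diag(e^{iθ}, e^{iθ}, e^{-2iθ}) ∈ SU(3)`,
`θ = π/(4L)` (`twistLink`, `twistCfg`), the twisted covariant shifts `F_μ = T_μ ⊗ g = linkHop` of
that field (`Fmat`, `linkHop_twistCfg`), their commutation/unitarity, and `g^{2L} = diag(i,i,-1)`,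
which has no eigenvalue `1` (`twistDiag_pow_ne_one`) — the ingredient that excludes zero modes of
the free Wilson operator at every mass (`TwistedFreeWilsonDirac.lean`; 't Hooft-type constant
abelian twists, Montvay–Münster 1994 §4.2).

Not here: eigen-decomposition / lattice momenta, antiperiodic shifts (see `WilsonDiracAP.lean`).
Origin: lean-checked by a stub worker of crux `PauliWegnerSea.FMClosureUnquenched`
(stmt-QuantumFields-11512), restyled for the Literature tree.
-/

noncomputable section

open scoped Kronecker ComplexOrder
open Matrix Complex
open Literature.MathematicalPhysics.QuantumFieldTheory
open Literature.Probability.LatticeModels (TorusSite)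

namespace Literature.MathematicalPhysics.QuantumLattice

section Shift

variable {L : ℕ}

/-- The forward site shift in direction `μ` on the torus `(ℤ/L)⁴` as a `0/1` matrix:
`T_μ(x,y) = [y = x + μ̂]`, i.e. `(T_μ ψ)(x) = ψ(x + μ̂)`. [folklore] -/
def torusShiftMat (L : ℕ) (μ : Fin 4) : Matrix (TorusSite 4 L) (TorusSite 4 L) ℂ :=
  Matrix.of fun x y => if y = Site.shift x μ then 1 else 0

/-- Entries of the shift matrix. [folklore] -/
@[simp] theorem torusShiftMat_apply (μ : Fin 4) (x y : TorusSite 4 L) :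
    torusShiftMat L μ x y = if y = Site.shift x μ then 1 else 0 := rfl

variable [NeZero L]

/-- The shifts commute: `T_μ T_ν = T_ν T_μ` (translations of an abelian group). [folklore] -/
theorem torusShiftMat_comm (μ ν : Fin 4) :
    torusShiftMat L μ * torusShiftMat L ν = torusShiftMat L ν * torusShiftMat L μ := by
  ext x z
  simp only [torusShiftMat, Matrix.mul_apply, Matrix.of_apply, boole_mul, Finset.sum_ite_eq',
    Finset.mem_univ, if_true]
  have : Site.shift (Site.shift x μ) ν = Site.shift (Site.shift x ν) μ := by
    simp only [Site.shift]; abel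
  rw [this]

/-- `T_μ T_νᴴ = T_νᴴ T_μ`. [folklore] -/
theorem torusShiftMat_mul_conjTranspose_comm (μ ν : Fin 4) :
    torusShiftMat L μ * (torusShiftMat L ν)ᴴ = (torusShiftMat L ν)ᴴ * torusShiftMat L μ := by
  ext x z
  simp only [torusShiftMat, Matrix.mul_apply, Matrix.conjTranspose_apply, Matrix.of_apply,
    star_ite_zero, star_one, boole_mul, Finset.sum_ite_eq', Finset.mem_univ, if_true]
  simp only [eq_shift_iff x, Finset.sum_ite_eq', Finset.mem_univ, if_true]
  have : (Site.shift x μ = Site.shift z ν) ↔ (z = Site.shift (x - Pi.single ν 1) μ) := by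
    simp only [Site.shift]
    constructor
    · intro h; linear_combination -h
    · intro h; linear_combination -h
  exact if_congr this rfl rfl

/-- The shift is unitary: `T_μ T_μᴴ = 1`. [folklore] -/
theorem torusShiftMat_mul_conjTranspose_self (μ : Fin 4) :
    torusShiftMat L μ * (torusShiftMat L μ)ᴴ = 1 := by
  ext x z
  simp only [torusShiftMat, Matrix.mul_apply, Matrix.conjTranspose_apply, Matrix.of_apply,
    star_ite_zero, star_one, boole_mul, Finset.sum_ite_eq', Finset.mem_univ, if_true]
  simp only [Matrix.one_apply, Site.shift, add_left_inj]

/-- Powers of the shift: `T_μ^k (x,y) = [y = x + k μ̂]`. [folklore] -/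
theorem torusShiftMat_pow (μ : Fin 4) (k : ℕ) :
    torusShiftMat L μ ^ k =
      Matrix.of fun x y => if y = x + k • Pi.single μ (1 : ZMod L) then 1 else 0 := by
  induction k with
  | zero =>
      ext x y
      simp only [pow_zero, Matrix.one_apply, Matrix.of_apply, zero_smul, add_zero, eq_comm]
  | succ k ih =>
      ext x z
      rw [pow_succ, ih]
      simp only [torusShiftMat, Matrix.mul_apply, Matrix.of_apply, boole_mul, Finset.sum_ite_eq',
        Finset.mem_univ, if_true, Site.shift, succ_nsmul, add_assoc]

/-- **Periodicity**: `T_μ^L = 1` on the torus of side `L`. [folklore] -/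
theorem torusShiftMat_pow_self (μ : Fin 4) : torusShiftMat L μ ^ L = 1 := by
  rw [torusShiftMat_pow]
  ext x y
  have h0 : (L : ℕ) • Pi.single μ (1 : ZMod L) = (0 : TorusSite 4 L) := by
    ext i
    simp [Pi.single_apply, nsmul_eq_mul]
  simp only [h0, add_zero, Matrix.of_apply, Matrix.one_apply, eq_comm]

omit [NeZero L] in
/-- The gauge-covariant forward shift of a CONSTANT link field `U ≡ g` is `T_μ ⊗ ρ(g)`
(site ⊗ colour). [folklore] -/
theorem linkHop_const {G : Type*} [Group G] {N : ℕ} (ρ : G →* Matrix (Fin N) (Fin N) ℂ) (g : G)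
    (μ : Fin 4) :
    linkHop ρ (fun _ : QuantumFieldTheory.Edge 4 L => g) μ =
      torusShiftMat L μ ⊗ₖ ρ g := by
  ext ⟨x, a⟩ ⟨y, b⟩
  simp only [linkHop, torusShiftMat, Matrix.of_apply, Matrix.kroneckerMap_apply, boole_mul]

end Shift

/-! ## The constant diagonal `SU(3)` twist and its covariant shifts

A constant link field `U₀ ≡ g = diag(e^{iθ}, e^{iθ}, e^{-2iθ})`, `θ = π/(4L)`, for which the twisted
forward shifts `F_μ = T_μ ⊗ g` are commuting unitaries with `F_μ^{2L} = 1 ⊗ diag(i, i, -1)` — no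
eigenvalue `1` — the input of the zero-mode exclusion in `TwistedFreeWilsonDirac.lean`. -/

namespace TwistedFreeWilson

local notation "𝔾" => Matrix.specialUnitaryGroup (Fin 3) ℂ

/-! ### The twisted link -/

variable {L : ℕ}

/-- The twist angles `(θ, θ, -2θ)`, `θ = π/(4L)`. [folklore] -/
def twistArg (L : ℕ) : Fin 3 → ℝ :=
  ![Real.pi / (4 * L), Real.pi / (4 * L), -(2 * (Real.pi / (4 * L)))]

/-- The diagonal phases `e^{iθ_a}`. [folklore] -/
def twistDiag (L : ℕ) : Fin 3 → ℂ := fun a => Complex.exp (twistArg L a * Complex.I)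

/-- The twist phases are unimodular. [folklore] -/
theorem twistDiag_mul_conj (a : Fin 3) : twistDiag L a * star (twistDiag L a) = 1 := by
  rw [Complex.star_def, Complex.mul_conj, Complex.normSq_eq_norm_sq, twistDiag,
    Complex.norm_exp_ofReal_mul_I]
  simp

/-- The twisted link `g = diag(e^{iθ}, e^{iθ}, e^{-2iθ})` lies in `SU(3)`. [folklore] -/
theorem twistMat_mem : Matrix.diagonal (twistDiag L) ∈ Matrix.specialUnitaryGroup (Fin 3) ℂ := by
  rw [Matrix.mem_specialUnitaryGroup_iff, Matrix.mem_unitaryGroup_iff, Matrix.det_diagonal]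
  refine ⟨?_, ?_⟩
  · rw [Matrix.star_eq_conjTranspose, Matrix.diagonal_conjTranspose, Matrix.diagonal_mul_diagonal,
      ← Matrix.diagonal_one]
    congr 1
    funext a
    exact twistDiag_mul_conj a
  · rw [Fin.prod_univ_three]
    simp only [twistDiag, twistArg, ← Complex.exp_add]
    convert Complex.exp_zero using 2
    simp only [Matrix.cons_val_zero, Matrix.cons_val_one, Matrix.cons_val_two,
      Matrix.tail_cons, Matrix.head_cons]
    push_cast
    ring

/-- `g gᴴ = 1` for the twisted link. [folklore] -/
theorem twist_mul_conjTranspose :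
    Matrix.diagonal (twistDiag L) * (Matrix.diagonal (twistDiag L))ᴴ = 1 := by
  have h := (Matrix.mem_specialUnitaryGroup_iff.1 (twistMat_mem (L := L))).1
  rwa [Matrix.mem_unitaryGroup_iff, Matrix.star_eq_conjTranspose] at h

/-- `gᴴ g = 1` for the twisted link. [folklore] -/
theorem twist_conjTranspose_mul :
    (Matrix.diagonal (twistDiag L))ᴴ * Matrix.diagonal (twistDiag L) = 1 := by
  have h := (Matrix.mem_specialUnitaryGroup_iff.1 (twistMat_mem (L := L))).1
  rwa [Matrix.mem_unitaryGroup_iff', Matrix.star_eq_conjTranspose] at h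

variable [NeZero L]

/-- `g^{2L} = diag(i, i, -1)` has no eigenvalue `1`: `(e^{iθ_a})^{2L} ≠ 1`. [folklore] -/
theorem twistDiag_pow_ne_one (a : Fin 3) : twistDiag L a ^ (2 * L) ≠ 1 := by
  have hL : (L : ℂ) ≠ 0 := Nat.cast_ne_zero.2 (NeZero.ne L)
  rw [twistDiag, ← Complex.exp_nat_mul]
  fin_cases a
  · -- `exp(i π/2) = i`
    have : ((2 * L : ℕ) : ℂ) * ((twistArg L 0 : ℝ) * Complex.I) = (Real.pi / 2 : ℝ) * Complex.I := by
      simp only [twistArg, Matrix.cons_val_zero]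
      push_cast
      field_simp
      ring
    rw [show (⟨0, by norm_num⟩ : Fin 3) = 0 from rfl, this, Complex.exp_mul_I]
    intro h
    have h' := congrArg Complex.re h
    simp at h'
  · have : ((2 * L : ℕ) : ℂ) * ((twistArg L 1 : ℝ) * Complex.I) = (Real.pi / 2 : ℝ) * Complex.I := by
      simp only [twistArg, Matrix.cons_val_one]
      push_cast
      field_simp
      ring
    rw [show (⟨1, by norm_num⟩ : Fin 3) = 1 from rfl, this, Complex.exp_mul_I]
    intro h
    have h' := congrArg Complex.re h
    simp at h'
  · -- `exp(-i π) = -1`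
    have : ((2 * L : ℕ) : ℂ) * ((twistArg L 2 : ℝ) * Complex.I) = (-Real.pi : ℝ) * Complex.I := by
      simp only [twistArg, Matrix.cons_val_two, Matrix.tail_cons, Matrix.head_cons]
      push_cast
      field_simp
      ring
    rw [show (⟨2, by norm_num⟩ : Fin 3) = 2 from rfl, this, Complex.exp_mul_I]
    intro h
    have h' := congrArg Complex.re h
    simp at h'
    norm_num at h'

/-! ### The constant twisted gauge field and its Wilson operator in Kronecker form -/

/-- The twisted link as an element of `SU(3)`. [folklore] -/
def twistLink (L : ℕ) : 𝔾 := ⟨Matrix.diagonal (twistDiag L), twistMat_mem⟩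

/-- The constant twisted gauge field `U₀ ≡ g`. [folklore] -/
def twistCfg (L : ℕ) : GaugeConfig 4 L 𝔾 := fun _ => twistLink L

variable (L)

/-- Site × colour index. [folklore] -/
abbrev VIdx : Type := TorusSite 4 L × Fin 3

/-- The twisted forward shift `F_μ = T_μ ⊗ g`. [folklore] -/
def Fmat (μ : Fin 4) : Matrix (VIdx L) (VIdx L) ℂ := torusShiftMat L μ ⊗ₖ Matrix.diagonal (twistDiag L)

variable {L}

omit [NeZero L] in
/-- `F_μ = linkHop` of the twisted field. [folklore] -/
theorem linkHop_twistCfg (μ : Fin 4) : linkHop (fundamentalRep (Fin 3)) (twistCfg L) μ = Fmat L μ := by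
  ext ⟨x, a⟩ ⟨y, b⟩
  simp only [linkHop, twistCfg, twistLink, Fmat, torusShiftMat, Matrix.of_apply,
    Matrix.kroneckerMap_apply, fundamentalRep_apply, boole_mul]

/-- The twisted shifts commute. [folklore] -/
theorem Fmat_comm (μ ν : Fin 4) : Fmat L μ * Fmat L ν = Fmat L ν * Fmat L μ := by
  rw [Fmat, Fmat, ← mul_kronecker_mul, ← mul_kronecker_mul, torusShiftMat_comm]

/-- `F_μ F_νᴴ = F_νᴴ F_μ`. [folklore] -/
theorem Fmat_mul_conjTranspose_comm (μ ν : Fin 4) :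
    Fmat L μ * (Fmat L ν)ᴴ = (Fmat L ν)ᴴ * Fmat L μ := by
  rw [Fmat, Fmat, conjTranspose_kronecker, ← mul_kronecker_mul, ← mul_kronecker_mul,
    torusShiftMat_mul_conjTranspose_comm, twist_mul_conjTranspose, twist_conjTranspose_mul]

/-- `F_μ F_μᴴ = 1` (the twisted shifts are unitary). [folklore] -/
theorem Fmat_mul_conjTranspose_self (μ : Fin 4) : Fmat L μ * (Fmat L μ)ᴴ = 1 := by
  rw [Fmat, conjTranspose_kronecker, ← mul_kronecker_mul, twist_mul_conjTranspose,
    torusShiftMat_mul_conjTranspose_self, one_kronecker_one]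

end TwistedFreeWilson

end Literature.MathematicalPhysics.QuantumLattice

namespace Literature.MathematicalPhysics.QuantumLattice

/-! ### Kronecker bookkeeping -/

section KroneckerHelpers

variable {m n : Type*}

/-- `(A₁ - A₂) ⊗ B = A₁ ⊗ B - A₂ ⊗ B` (local copy of `XYOrderGDProofs.sub_kronecker`). [folklore] -/
private theorem sub_kronecker' (A₁ A₂ : Matrix m m ℂ) (B : Matrix n n ℂ) :
    (A₁ - A₂) ⊗ₖ B = A₁ ⊗ₖ B - A₂ ⊗ₖ B := by
  ext ⟨i, k⟩ ⟨j, l⟩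
  simp [kroneckerMap_apply, sub_mul]

/-- `(-A) ⊗ B = -(A ⊗ B)` (local copy of `LiebFluxPhaseSplit.neg_kronecker`). [folklore] -/
private theorem neg_kronecker' (A : Matrix m m ℂ) (B : Matrix n n ℂ) : (-A) ⊗ₖ B = -(A ⊗ₖ B) := by
  ext ⟨i, j⟩ ⟨i', j'⟩
  simp [kroneckerMap_apply]

/-- `A ⊗ (-B) = -(A ⊗ B)` (local copy of `LiebFluxPhaseSplit.kronecker_neg`). [folklore] -/
private theorem kronecker_neg' (A : Matrix m m ℂ) (B : Matrix n n ℂ) : A ⊗ₖ (-B) = -(A ⊗ₖ B) := by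
  ext ⟨i, j⟩ ⟨i', j'⟩
  simp [kroneckerMap_apply]

/-- `(Σᵢ Aᵢ) ⊗ B = Σᵢ Aᵢ ⊗ B` (local copy of `XYOrderGDProofs.sum_kronecker`). [folklore] -/
private theorem sum_kronecker' {ι : Type*} (s : Finset ι) (A : ι → Matrix m m ℂ) (B : Matrix n n ℂ) :
    (∑ i ∈ s, A i) ⊗ₖ B = ∑ i ∈ s, A i ⊗ₖ B := by
  ext ⟨i, k⟩ ⟨j, l⟩
  simp [kroneckerMap_apply, Matrix.sum_apply, Finset.sum_mul]

/-- `(A ⊗ B)^k = A^k ⊗ B^k`. [folklore] -/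
private theorem kronecker_pow' [Fintype m] [Fintype n] [DecidableEq m] [DecidableEq n]
    (A : Matrix m m ℂ) (B : Matrix n n ℂ) (k : ℕ) : (A ⊗ₖ B) ^ k = (A ^ k) ⊗ₖ (B ^ k) := by
  induction k with
  | zero => simp
  | succ k ih => rw [pow_succ, ih, ← mul_kronecker_mul, ← pow_succ, ← pow_succ]

/-- `(diag 1 ⊗ diag w) ⊗ diag 1` acts diagonally. [folklore] -/
private theorem one_kronecker_diagonal_kronecker_one_mulVec [Fintype m] [DecidableEq m] [Fintype n]
    [DecidableEq n] {k : Type*} [Fintype k] [DecidableEq k] (w : k → ℂ) (ψ : (m × k) × n → ℂ)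
    (x : m) (a : k) (i : n) :
    ((((1 : Matrix m m ℂ) ⊗ₖ Matrix.diagonal w) ⊗ₖ (1 : Matrix n n ℂ)) *ᵥ ψ) ((x, a), i) =
      w a * ψ ((x, a), i) := by
  rw [show (1 : Matrix m m ℂ) = Matrix.diagonal (fun _ => 1) from Matrix.diagonal_one.symm,
    show (1 : Matrix n n ℂ) = Matrix.diagonal (fun _ => 1) from Matrix.diagonal_one.symm,
    diagonal_kronecker_diagonal, diagonal_kronecker_diagonal, mulVec_diagonal]
  simp

end KroneckerHelpers

/-! ### An abstract Clifford factorisation -/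

section Clifford

variable {W : Type*} [Fintype W] [DecidableEq W]

/-- The square of a sum of four pairwise anticommuting matrices is the sum of their squares. [folklore] -/
theorem sum_mul_sum_of_anticomm (Q : Fin 4 → Matrix W W ℂ)
    (h : ∀ μ ν, μ ≠ ν → Q μ * Q ν = -(Q ν * Q μ)) :
    (∑ μ, Q μ) * (∑ μ, Q μ) = ∑ μ, Q μ * Q μ := by
  have h10 := h 1 0 (by decide)
  have h20 := h 2 0 (by decide)
  have h30 := h 3 0 (by decide)
  have h21 := h 2 1 (by decide)
  have h31 := h 3 1 (by decide)
  have h32 := h 3 2 (by decide)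
  simp only [Fin.sum_univ_four, add_mul, mul_add]
  rw [h10, h20, h30, h21, h31, h32]
  abel

/-- `(P + ΣQ)(P − ΣQ) = P² − Σ Q_μ²` when `P` commutes with every `Q_μ` and the `Q_μ` pairwise
anticommute. [folklore] -/
theorem clifford_factor (P : Matrix W W ℂ) (Q : Fin 4 → Matrix W W ℂ)
    (hPQ : ∀ μ, P * Q μ = Q μ * P) (hQQ : ∀ μ ν, μ ≠ ν → Q μ * Q ν = -(Q ν * Q μ)) :
    (P + ∑ μ, Q μ) * (P - ∑ μ, Q μ) = P * P - ∑ μ, Q μ * Q μ := by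
  have hc : Commute P (∑ μ, Q μ) := Commute.sum_right _ _ _ fun μ _ => hPQ μ
  rw [← hc.mul_self_sub_mul_self_eq, sum_mul_sum_of_anticomm Q hQQ]

end Clifford

namespace TwistedFreeWilson

variable (L : ℕ) [NeZero L]

/-! ### The Wilson operator of the twisted field in Kronecker form -/

/-- `A = 2(m+4) − Σ_μ (F_μ + F_μᴴ)`. [folklore] -/
def Amat (m : ℝ) : Matrix (VIdx L) (VIdx L) ℂ :=
  ((2 * (m + 4) : ℝ) : ℂ) • (1 : Matrix (VIdx L) (VIdx L) ℂ) - ∑ μ, (Fmat L μ + (Fmat L μ)ᴴ)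

/-- `G_μ = F_μᴴ − F_μ`. [folklore] -/
def Gmat (μ : Fin 4) : Matrix (VIdx L) (VIdx L) ℂ := (Fmat L μ)ᴴ - Fmat L μ

/-- `P = A ⊗ 1`. [folklore] -/
def Pmat (m : ℝ) : Matrix (VIdx L × Fin 4) (VIdx L × Fin 4) ℂ :=
  Amat L m ⊗ₖ (1 : Matrix (Fin 4) (Fin 4) ℂ)

/-- `Q_μ = G_μ ⊗ γ_μ`. [folklore] -/
def Qmat (μ : Fin 4) : Matrix (VIdx L × Fin 4) (VIdx L × Fin 4) ℂ :=
  Gmat L μ ⊗ₖ euclideanGamma μ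

/-- The Wilson operator of the twisted field in Kronecker coordinates `(site × colour) × spin`. [folklore] -/
def Dk (m : ℝ) : Matrix (VIdx L × Fin 4) (VIdx L × Fin 4) ℂ :=
  ((m + 4 : ℝ) : ℂ) • (1 : Matrix (VIdx L × Fin 4) (VIdx L × Fin 4) ℂ) -
    ∑ μ, (Fmat L μ ⊗ₖ chiralProjMinus μ + (Fmat L μ)ᴴ ⊗ₖ chiralProjPlus μ)

variable {L}

/-- `A` commutes with every `G_μ`. [folklore] -/
theorem Amat_comm_Gmat (m : ℝ) (μ : Fin 4) : Amat L m * Gmat L μ = Gmat L μ * Amat L m := by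
  have h : Commute (Amat L m) (Gmat L μ) := by
    refine Commute.sub_left (Commute.smul_left (Commute.one_left _) _)
      (Commute.sum_left _ _ _ fun ν _ => Commute.add_left (Commute.sub_right ?_ ?_)
        (Commute.sub_right ?_ ?_))
    · exact Fmat_mul_conjTranspose_comm ν μ
    · exact Fmat_comm ν μ
    · show (Fmat L ν)ᴴ * (Fmat L μ)ᴴ = (Fmat L μ)ᴴ * (Fmat L ν)ᴴ
      rw [← conjTranspose_mul, ← conjTranspose_mul, Fmat_comm]
    · exact (Fmat_mul_conjTranspose_comm μ ν).symm
  exact h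

/-- The `G_μ` commute. [folklore] -/
theorem Gmat_comm (μ ν : Fin 4) : Gmat L μ * Gmat L ν = Gmat L ν * Gmat L μ := by
  have h : Commute (Gmat L μ) (Gmat L ν) := by
    refine Commute.sub_left (Commute.sub_right ?_ ?_) (Commute.sub_right ?_ ?_)
    · show (Fmat L μ)ᴴ * (Fmat L ν)ᴴ = (Fmat L ν)ᴴ * (Fmat L μ)ᴴ
      rw [← conjTranspose_mul, ← conjTranspose_mul, Fmat_comm]
    · exact (Fmat_mul_conjTranspose_comm ν μ).symm
    · exact Fmat_mul_conjTranspose_comm μ ν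
    · exact Fmat_comm μ ν
  exact h

/-- `P` commutes with every `Q_μ`. [folklore] -/
theorem Pmat_mul_Qmat (m : ℝ) (μ : Fin 4) : Pmat L m * Qmat L μ = Qmat L μ * Pmat L m := by
  simp only [Pmat, Qmat, ← mul_kronecker_mul, Matrix.one_mul, Matrix.mul_one, Amat_comm_Gmat]

/-- The `Q_μ` pairwise anticommute (Clifford relations of the `γ_μ`, commuting `G_μ`). [folklore] -/
theorem Qmat_anticomm (μ ν : Fin 4) (hμν : μ ≠ ν) : Qmat L μ * Qmat L ν = -(Qmat L ν * Qmat L μ) := by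
  simp only [Qmat, ← mul_kronecker_mul]
  rw [euclideanGamma_mul_of_ne hμν, Gmat_comm μ ν, kronecker_neg']

omit [NeZero L] in
/-- `A` is Hermitian. [folklore] -/
theorem Amat_conjTranspose (m : ℝ) : (Amat L m)ᴴ = Amat L m := by
  simp only [Amat, conjTranspose_sub, conjTranspose_smul, conjTranspose_one, conjTranspose_sum,
    conjTranspose_add, conjTranspose_conjTranspose, Complex.star_def, Complex.conj_ofReal]
  simp only [add_comm]

omit [NeZero L] in
/-- `P` is Hermitian. [folklore] -/
theorem Pmat_conjTranspose (m : ℝ) : (Pmat L m)ᴴ = Pmat L m := by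
  rw [Pmat, conjTranspose_kronecker, conjTranspose_one, Amat_conjTranspose]

omit [NeZero L] in
/-- `Q_μ` is skew-Hermitian. [folklore] -/
theorem Qmat_conjTranspose (μ : Fin 4) : (Qmat L μ)ᴴ = -Qmat L μ := by
  rw [Qmat, conjTranspose_kronecker, (euclideanGamma_isHermitian μ).eq, Gmat, conjTranspose_sub,
    conjTranspose_conjTranspose, ← neg_sub, neg_kronecker']

omit [NeZero L] in
/-- `2 D = P − Σ_μ Q_μ`. [folklore] -/
theorem two_smul_Dk (m : ℝ) : (2 : ℂ) • Dk L m = Pmat L m - ∑ μ, Qmat L μ := by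
  have hK : ∀ μ, (2 : ℂ) • (Fmat L μ ⊗ₖ chiralProjMinus μ + (Fmat L μ)ᴴ ⊗ₖ chiralProjPlus μ) =
      (Fmat L μ + (Fmat L μ)ᴴ) ⊗ₖ (1 : Matrix (Fin 4) (Fin 4) ℂ) + Qmat L μ := fun μ => by
    ext ⟨v, i⟩ ⟨w, j⟩
    simp only [Qmat, Gmat, Matrix.smul_apply, Matrix.add_apply, Matrix.sub_apply,
      Matrix.kroneckerMap_apply, chiralProjMinus, chiralProjPlus, Matrix.one_apply, smul_eq_mul]
    split_ifs <;> ring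
  have hc : (2 : ℂ) • ((((m + 4 : ℝ) : ℂ)) • (1 : Matrix (VIdx L × Fin 4) (VIdx L × Fin 4) ℂ)) =
      (((2 * (m + 4) : ℝ)) : ℂ) • ((1 : Matrix (VIdx L) (VIdx L) ℂ) ⊗ₖ (1 : Matrix (Fin 4) (Fin 4) ℂ)) := by
    rw [smul_smul, one_kronecker_one]
    push_cast
    rfl
  unfold Dk
  rw [smul_sub, Finset.smul_sum]
  simp only [hK]
  rw [Finset.sum_add_distrib, hc, Pmat, Amat, sub_kronecker', smul_kronecker, sum_kronecker']
  abel

/-- Reindexing commutes with `c • 1 − Σ`. [folklore] -/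
theorem reindex_smul_one_sub_sum {M N : Type*} [DecidableEq M] [DecidableEq N]
    (e : M ≃ N) (c : ℂ) (X : Fin 4 → Matrix M M ℂ) :
    Matrix.reindex e e (c • (1 : Matrix M M ℂ) - ∑ μ, X μ) =
      c • (1 : Matrix N N ℂ) - ∑ μ, Matrix.reindex e e (X μ) := by
  ext p q
  simp only [Matrix.reindex_apply, Matrix.submatrix_apply, Matrix.sub_apply, Matrix.smul_apply,
    Matrix.sum_apply, Matrix.one_apply, e.symm.injective.eq_iff]

omit [NeZero L] in
/-- The Wilson operator of the twisted field is the reindexed `Dk`. [folklore] -/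
theorem wilsonDirac_twistCfg (m : ℝ) :
    wilsonDirac (fundamentalRep (Fin 3)) (twistCfg L) m 1 =
      Matrix.reindex (Equiv.prodAssoc _ _ _) (Equiv.prodAssoc _ _ _) (Dk L m) := by
  rw [wilsonDirac_eq_sub_sum_wilsonHop (fundamentalRep (Fin 3)) fundamentalRep_mem_unitaryGroup,
    Dk, reindex_smul_one_sub_sum]
  simp only [wilsonHop, linkHop_twistCfg]

/-- **The twisted free Wilson operator is injective at every real mass.** [folklore] -/
theorem Dk_mulVec_eq_zero_imp (m : ℝ) (ψ : VIdx L × Fin 4 → ℂ) (hψ : Dk L m *ᵥ ψ = 0) : ψ = 0 := by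
  have hPQ : ∀ μ, Pmat L m * Qmat L μ = Qmat L μ * Pmat L m := Pmat_mul_Qmat m
  have hQQ : ∀ μ ν, μ ≠ ν → Qmat L μ * Qmat L ν = -(Qmat L ν * Qmat L μ) := Qmat_anticomm
  -- `(P − ΣQ) ψ = 0`
  have h1 : (Pmat L m - ∑ μ, Qmat L μ) *ᵥ ψ = 0 := by
    rw [← two_smul_Dk, Matrix.smul_mulVec, hψ, smul_zero]
  -- `(P² − Σ Q²) ψ = 0`
  have h2 : (Pmat L m * Pmat L m - ∑ μ, Qmat L μ * Qmat L μ) *ᵥ ψ = 0 := by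
    rw [← clifford_factor _ _ hPQ hQQ, ← Matrix.mulVec_mulVec, h1, Matrix.mulVec_zero]
  -- the quadratic form `‖Pψ‖² + Σ ‖Q_μ ψ‖² = 0`
  have h3 : star (Pmat L m *ᵥ ψ) ⬝ᵥ (Pmat L m *ᵥ ψ) +
      ∑ μ, star (Qmat L μ *ᵥ ψ) ⬝ᵥ (Qmat L μ *ᵥ ψ) = 0 := by
    have h := congrArg (fun w => star ψ ⬝ᵥ w) h2
    simp only [dotProduct_zero, Matrix.sub_mulVec, Matrix.sum_mulVec, ← Matrix.mulVec_mulVec] at h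
    rw [dotProduct_sub, dotProduct_sum] at h
    have hPh : star ψ ᵥ* Pmat L m = star (Pmat L m *ᵥ ψ) := by
      rw [Matrix.star_mulVec, Pmat_conjTranspose]
    have hQh : ∀ μ, star ψ ᵥ* Qmat L μ = -star (Qmat L μ *ᵥ ψ) := fun μ => by
      rw [Matrix.star_mulVec, Qmat_conjTranspose, Matrix.vecMul_neg, neg_neg]
    have hPterm : star ψ ⬝ᵥ (Pmat L m *ᵥ (Pmat L m *ᵥ ψ)) =
        star (Pmat L m *ᵥ ψ) ⬝ᵥ (Pmat L m *ᵥ ψ) := by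
      rw [Matrix.dotProduct_mulVec, hPh]
    have hQterm : ∀ μ, star ψ ⬝ᵥ (Qmat L μ *ᵥ (Qmat L μ *ᵥ ψ)) =
        -(star (Qmat L μ *ᵥ ψ) ⬝ᵥ (Qmat L μ *ᵥ ψ)) := fun μ => by
      rw [Matrix.dotProduct_mulVec, hQh, neg_dotProduct]
    simp only [hPterm, hQterm, Finset.sum_neg_distrib, sub_neg_eq_add] at h
    exact h
  have hnonneg : ∀ μ, 0 ≤ star (Qmat L μ *ᵥ ψ) ⬝ᵥ (Qmat L μ *ᵥ ψ) := fun μ =>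
    dotProduct_star_self_nonneg _
  have h4 : star (Qmat L 0 *ᵥ ψ) ⬝ᵥ (Qmat L 0 *ᵥ ψ) = 0 := by
    have hs0 : 0 ≤ ∑ μ, star (Qmat L μ *ᵥ ψ) ⬝ᵥ (Qmat L μ *ᵥ ψ) :=
      Finset.sum_nonneg fun μ _ => hnonneg μ
    have hp0 : 0 ≤ star (Pmat L m *ᵥ ψ) ⬝ᵥ (Pmat L m *ᵥ ψ) := dotProduct_star_self_nonneg _
    have hsum := ((add_eq_zero_iff_of_nonneg hp0 hs0).1 h3).2
    exact (Finset.sum_eq_zero_iff_of_nonneg (fun μ _ => hnonneg μ)).1 hsum 0 (Finset.mem_univ _)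
  have h5 : Qmat L 0 *ᵥ ψ = 0 := dotProduct_star_self_eq_zero.1 h4
  -- `(G_0 ⊗ 1) ψ = 0`
  have h6 : (Gmat L 0 ⊗ₖ (1 : Matrix (Fin 4) (Fin 4) ℂ)) *ᵥ ψ = 0 := by
    have : ((1 : Matrix (VIdx L) (VIdx L) ℂ) ⊗ₖ euclideanGamma 0) * Qmat L 0 =
        Gmat L 0 ⊗ₖ (1 : Matrix (Fin 4) (Fin 4) ℂ) := by
      rw [Qmat, ← mul_kronecker_mul, Matrix.one_mul, euclideanGamma_mul_self]
    rw [← this, ← Matrix.mulVec_mulVec, h5, Matrix.mulVec_zero]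
  -- `N ψ = Nᴴ ψ`, `N = F_0 ⊗ 1` unitary, hence `N² ψ = ψ`
  set N : Matrix (VIdx L × Fin 4) (VIdx L × Fin 4) ℂ :=
    Fmat L 0 ⊗ₖ (1 : Matrix (Fin 4) (Fin 4) ℂ) with hN
  have h7 : N *ᵥ ψ = Nᴴ *ᵥ ψ := by
    have : Gmat L 0 ⊗ₖ (1 : Matrix (Fin 4) (Fin 4) ℂ) = Nᴴ - N := by
      rw [hN, Gmat, sub_kronecker', conjTranspose_kronecker, conjTranspose_one]
    rw [this, Matrix.sub_mulVec, sub_eq_zero] at h6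
    exact h6.symm
  have hNN : N * Nᴴ = 1 := by
    rw [hN, conjTranspose_kronecker, conjTranspose_one, ← mul_kronecker_mul, Matrix.mul_one,
      Fmat_mul_conjTranspose_self, one_kronecker_one]
  have h8 : (N * N) *ᵥ ψ = ψ := by
    rw [← Matrix.mulVec_mulVec, h7, Matrix.mulVec_mulVec, hNN, Matrix.one_mulVec]
  have h9 : ∀ k : ℕ, ((N * N) ^ k) *ᵥ ψ = ψ := by
    intro k
    induction k with
    | zero => simp
    | succ k ih => rw [pow_succ, ← Matrix.mulVec_mulVec, h8, ih]
  -- `(N N)^L = (1 ⊗ g^{2L}) ⊗ 1`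
  have hpow : (N * N) ^ L =
      ((1 : Matrix (TorusSite 4 L) (TorusSite 4 L) ℂ) ⊗ₖ
          Matrix.diagonal (fun a => twistDiag L a ^ (2 * L))) ⊗ₖ (1 : Matrix (Fin 4) (Fin 4) ℂ) := by
    rw [← sq, ← pow_mul, hN, kronecker_pow', one_pow, Fmat, kronecker_pow', mul_comm 2 L, pow_mul,
      torusShiftMat_pow_self, one_pow, ← mul_comm 2 L, diagonal_pow]
    rfl
  have h10 := h9 L
  rw [hpow] at h10
  funext p
  obtain ⟨⟨x, a⟩, i⟩ := p
  have hp := congrFun h10 ((x, a), i)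
  rw [one_kronecker_diagonal_kronecker_one_mulVec] at hp
  have hz : (twistDiag L a ^ (2 * L) - 1) * ψ ((x, a), i) = 0 := by
    rw [sub_mul, one_mul, hp, sub_self]
  rcases mul_eq_zero.1 hz with h | h
  · exact absurd (sub_eq_zero.1 h) (twistDiag_pow_ne_one a)
  · simpa using h

end TwistedFreeWilson

open TwistedFreeWilson in
/-- **The Wilson–Dirac operator of the constant twisted `SU(3)` field `U₀ ≡ diag(e^{iπ/4L},
e^{iπ/4L}, e^{-iπ/2L})` has non-zero determinant at every real bare mass**, on every periodic
torus `(ℤ/L)⁴`, `L ≥ 1` (Montvay–Münster 1994 §4.2: the free Wilson propagator is singular only at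
momenta with all `sin p_μ = 0`; the colour twist shifts the momenta off that set). [folklore] -/
theorem wilsonDirac_twistCfg_det_ne_zero {L : ℕ} [NeZero L] (m : ℝ) :
    (wilsonDirac (fundamentalRep (Fin 3)) (twistCfg L) m 1).det ≠ 0 := by
  rw [wilsonDirac_twistCfg, Matrix.det_reindex_self]
  intro hdet
  obtain ⟨v, hv, hDv⟩ := Matrix.exists_mulVec_eq_zero_iff.2 hdet
  exact hv (Dk_mulVec_eq_zero_imp m v hDv)

/-- **Some `SU(3)` gauge field has `det D_W ≠ 0` at every real bare mass**, on every periodic torus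
(existential form; the input of `integral_norm_det_diracMatrix_pos_of_exists`). [folklore] -/
theorem exists_gaugeConfig_wilsonDirac_det_ne_zero (L : ℕ) [NeZero L] :
    ∃ U₀ : GaugeConfig 4 L (Matrix.specialUnitaryGroup (Fin 3) ℂ),
      ∀ m : ℝ, (wilsonDirac (fundamentalRep (Fin 3)) U₀ m 1).det ≠ 0 :=
  ⟨TwistedFreeWilson.twistCfg L, wilsonDirac_twistCfg_det_ne_zero⟩

end Literature.MathematicalPhysics.QuantumLattice

open MeasureTheory
open Literature.MathematicalPhysics.QuantumLattice Literature.Probability.LatticeModels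

namespace Literature.MathematicalPhysics.QuantumFieldTheory

variable {Nf : ℕ} {S : ℕ} [NeZero S]

/-- **The multi-flavour Wilson determinant of the constant twisted field is non-zero for every mass
tuple** (flavour by flavour `wilsonDirac_twistCfg_det_ne_zero`). [folklore] -/
theorem det_diracMatrix_twistCfg_ne_zero (mq : Fin Nf → ℝ) :
    (diracMatrix (TwistedFreeWilson.twistCfg S) mq).det ≠ 0 :=
  det_diracMatrix_ne_zero_of_forall _ _ fun f => wilsonDirac_twistCfg_det_ne_zero (mq f)

/-- **Positivity of the phase-quenched denominator for all parameters**: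
`0 < ∫ |det D(U)| dμ_W(β)` for every `N_f`, every bare-mass tuple, every real `β` and every torus
side `L ≥ 1` (the Wilson measure charges the open set where the continuous `|det D|` is positive,
which contains the constant twisted field). [folklore] -/
theorem integral_norm_det_diracMatrix_pos_all (β : ℝ) (mq : Fin Nf → ℝ) :
    0 < ∫ U, ‖(diracMatrix U mq).det‖
      ∂(wilsonMeasure (d := 4) (L := S) (fundamentalRep (Fin 3)) β) :=
  integral_norm_det_diracMatrix_pos_of_exists β mq
    ⟨TwistedFreeWilson.twistCfg S, det_diracMatrix_twistCfg_ne_zero mq⟩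

/-- The phase-quenched expectation is normalised at every parameter: `⟨c⟩₊ = c`. [folklore] -/
theorem qcdPhaseQuenchedExpect_const_all {E : Type*} [NormedAddCommGroup E] [NormedSpace ℝ E]
    [CompleteSpace E] (β : ℝ) (mq : Fin Nf → ℝ) (c : E) :
    qcdPhaseQuenchedExpect β S mq (fun _ => c) = c :=
  qcdPhaseQuenchedExpect_const β mq (integral_norm_det_diracMatrix_pos_all β mq).ne' c

/-- The phase-quenched lattice QCD measure is a probability measure at every parameter. [folklore] -/
theorem isProbabilityMeasure_qcdLatticeMeasure_all (β : ℝ) (mq : Fin Nf → ℝ) :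
    IsProbabilityMeasure (qcdLatticeMeasure S β mq) :=
  isProbabilityMeasure_qcdLatticeMeasure β mq (integral_norm_det_diracMatrix_pos_all β mq)

/-- **Jensen's inequality for `⟨·⟩₊` at every parameter**: for a convex continuous `g` on a closed
convex `s ⊆ ℝ` and a real observable `φ` with values a.e. in `s`, `g ⟨φ⟩₊ ≤ ⟨g ∘ φ⟩₊`
(`qcdPhaseQuenchedExpect_jensen` with its positivity hypothesis discharged). [folklore] -/
theorem qcdPhaseQuenchedExpect_jensen_all (β : ℝ) (mq : Fin Nf → ℝ)
    {s : Set ℝ} {g : ℝ → ℝ} (hg : ConvexOn ℝ s g) (hgc : ContinuousOn g s) (hs : IsClosed s)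
    (φ : GaugeConfig 4 S SU3 → ℝ) (hφs : ∀ᵐ U ∂(qcdLatticeMeasure S β mq), φ U ∈ s)
    (hφi : Integrable φ (qcdLatticeMeasure S β mq))
    (hgφi : Integrable (g ∘ φ) (qcdLatticeMeasure S β mq)) :
    g (qcdPhaseQuenchedExpect β S mq φ) ≤ qcdPhaseQuenchedExpect β S mq (g ∘ φ) :=
  qcdPhaseQuenchedExpect_jensen β mq (integral_norm_det_diracMatrix_pos_all β mq) hg hgc hs φ hφs
    hφi hgφi

end Literature.MathematicalPhysics.QuantumFieldTheory

end
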